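import Summits.CriticalPhenomena.PercolationContinuityZ3.Theorems.PercNearOneGluingNoHeavyQuantLawDecFlowsDecomposition
import HarnessLib

/-!
# QUANT lane R8, T-DEC, leg (III): the ONE-LAYER mixed-shift statement is FALSE — an explicit exact witness

builds on p205010 (kernel theorem, internal audit signed; external expert review pending)

Support file (`--supports stmt-CriticalPhenomena-4575`), QUANT lane seat prim-quant-arm-3 (gen 62; V278 second-seat literal test of lead g29's
`@[conjecture] LawDec.MixedShiftDEC`, `…QuantMixedShift`, p335352).  One theorem (plus two private rate-evaluation lemmas), standard axioms, no sorries, no definitions, no notation.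

THE STATEMENT UNDER TEST (lead g29): `ν` a top-affordable probability law on `{0..M}` (mean `S`, `y·M ≤ S`), `0 ≤ z ≤ ν 0`, `g ≤ 1`, `y ≤ (1−z)g`,
`1 ≤ a`, `W := shiftBut ν a z` (`= ν` with all but the mass `z` of its zero atom shifted up by `a`).  CLAIM: `ν` DEC at `(y, S, j)` and `W` DEC at
`(y, S + a(1−z), j)` ⟹ the mixture `(1−g)ν + gW` DEC at `(y, S + ag(1−z), j)` (all with top `M + a`).

THE WITNESS (this file, `mixedShift_oneLayer_witness`): `ν = {2: 1/12, 3: 1/36, 5: 1/12, 6: 29/36}`, `M = 6`, `S = 11/2`, `a = 1`, `j = 5`, `z = 0`,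
`y = g = 11/12` (top-affordability and the threshold both tight).  Hypothesis A holds (flow `2 → 5: 1/99`, `2 → 6: 29/396`; the giant `6` is exactly
full), hypothesis B holds (`W = {3: 1/12, 4: 1/36, 6: 1/12, 7: 29/36}`, flow `3 → 4: 1/396`, `3 → 6: 1/132`, `3 → 7: 29/396`), and the conclusion FAILS:
the mixture `{2: 1/144, 3: 17/216, 4: 11/432, 5: 1/144, 6: 31/216, 7: 319/432}` at target `77/12`, layer `5` has lows `{2, 3}` of mass `37/432` but —
with usages `u(2,5) = 49/5`, `u(3,4) = 7`, `u(3,5) = 247/41`, giants `11`, pair `(2,4)` incompatible — its absorbers ship at most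
`11/3024 + 41/35568 + 31/2376 + 29/432 < 37/432` (Farkas prices `α = (1,1)`, `β = (1/7, 41/247, 1/11, 1/11)`).  MECHANISM: the atom `3` of `ν` is an
absorber for hypothesis A (`2·3 ≥ S`) but a LOW in the `(1−g)`-copy of `ν` inside the mixture (target `77/12 > 6`), and A binds.  The all-layer
("window") forms are not affected: here `ν` is NOT DEC at layer `j − a = 4`.

* `mixedShift_oneLayer_witness` — `∃ y z g S a j M ν`, every hypothesis of the one-layer statement ∧ `¬` its conclusion (the binder of
  `LawDec.MixedShiftDEC` with `shiftBut` written out), via `decAtT_iff_flowAtT` and explicit flows / an explicit dual combination.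

Evidence: memo `run/shared/lean/prim/quant/prim-quant-arm-3-g62/MIXEDSHIFT-CEX-G62.md` (exact engine censuses: kit j168539 2 / 640 000 in a general
boundary-pushed census, 334 / 12 000 in the targeted family; slack and gated (`0 < z < ν 0`) variants fail too).

[this work]; the statement under test: prim-quant-lead g29 (this lane).  Nothing here is cited as a published result.  The gluing rows served
[cite: KozmaNitzan2024, Conjecture 3 (p. 15)]; product measure [cite: Grimmett1999, §1.3 p. 10].
-/

noncomputable section

namespace Summit.CriticalPhenomena.PercolationContinuityZ3.Theorems

namespace Quant

open Finset

namespace LawDec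

/-- usage of a low atom at a GIANT absorber `h ≥ j′+1` is `x/(1−x)`. -/
private theorem usage_of_giant (x T : ℝ) (j' l h : ℕ) (hjh : j' + 1 ≤ h) : usage x T j' l h = x / (1 - x) := by
  simp only [usage, gateOf, if_pos hjh]

/-- usage of a low atom at a MID absorber `h ≤ j′` when the credit gate is the heavy branch `x² + (1−x)ρ ≥ ρ`. -/
private theorem usage_of_mid (x T ρ : ℝ) (j' l h : ℕ) (hjh : ¬ j' + 1 ≤ h) (hρ : (T - 2 * (l : ℝ)) / ((h : ℝ) - l) = ρ)
    (hle : ρ ≤ x ^ 2 + (1 - x) * ρ) :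
    usage x T j' l h = (x ^ 2 + (1 - x) * ρ) / (1 - (x ^ 2 + (1 - x) * ρ)) := by
  simp only [usage, gateOf, if_neg hjh, pairGate, hρ, max_eq_right hle]

/-- **THE ONE-LAYER MIXED-SHIFT STATEMENT IS FALSE (arm-3 g62).**  There are `y z g S a j M ν` satisfying every hypothesis of
`LawDec.MixedShiftDEC` (lead g29; `shiftBut ν a z` written out as `h ↦ [h = 0]·z + [a ≤ h]·ν(h−a) − [h = a]·z`) whose conclusion fails:
`ν = {2: 1/12, 3: 1/36, 5: 1/12, 6: 29/36}`, `M = 6`, `S = 11/2`, `a = 1`, `j = 5`, `z = 0`, `y = g = 11/12`.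
Hypothesis A: flow `2 → 5: 1/99` (usage `127/17`), `2 → 6: 29/396` (usage `11`, the giant exactly full).  Hypothesis B (`W = {3: 1/12, 4: 1/36,
6: 1/12, 7: 29/36}` at target `13/2`): flow `3 → 4: 1/396` (usage `127/17`), `3 → 6: 1/132`, `3 → 7: 29/396` (usage `11`).  Conclusion (mixture
`{2: 1/144, 3: 17/216, 4: 11/432, 5: 1/144, 6: 31/216, 7: 319/432}` at target `77/12`, layer `5`): lows `{2, 3}` must ship `37/432`; the pair
`(2,4)` is incompatible; at usages `u(3,4) = 7`, `u(2,5) = 49/5`, `u(3,5) = 247/41`, giants `11` the absorbers take at most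
`11/3024 + 41/35568 + 31/2376 + 29/432 < 37/432`.
builds on p205010 (kernel theorem, internal audit signed; external expert review pending). [this work] -/
theorem mixedShift_oneLayer_witness :
    ∃ (y z g S : ℝ) (a j M : ℕ) (ν : ℕ → ℝ),
      0 < y ∧ y < 1 ∧ 0 ≤ z ∧ z ≤ ν 0 ∧ g ≤ 1 ∧ y ≤ (1 - z) * g ∧ 1 ≤ a ∧
      (∀ h, 0 ≤ ν h) ∧ (∀ h, M < h → ν h = 0) ∧ (∑ h ∈ Finset.range (M + 1), ν h = 1) ∧
      S = ∑ h ∈ Finset.range (M + 1), (h : ℝ) * ν h ∧ y * (M : ℝ) ≤ S ∧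
      DECAtT y S j (M + a) ν ∧
      DECAtT y (S + (a : ℝ) * (1 - z)) j (M + a)
        (fun h => (if h = 0 then z else 0) + (if a ≤ h then ν (h - a) else 0) - (if h = a then z else 0)) ∧
      ¬ DECAtT y (S + (a : ℝ) * g * (1 - z)) j (M + a)
        (fun h => (1 - g) * ν h + g * ((if h = 0 then z else 0) + (if a ≤ h then ν (h - a) else 0) - (if h = a then z else 0))) := by
  -- the three laws vanish above `7` (resp. `6`) and have mass `1`; `ν` has mean `11/2`
  have nu_top6 : ∀ h, 6 < h → (fun h : ℕ => (if h = 2 then (1 : ℝ) / 12 else if h = 3 then 1 / 36 else if h = 5 then 1 / 12 else if h = 6 then 29 / 36 else 0)) h = 0 := by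
    intro h hh; dsimp only; rw [if_neg (by omega), if_neg (by omega), if_neg (by omega), if_neg (by omega)]
  have nu_top : ∀ h, 7 < h → (fun h : ℕ => (if h = 2 then (1 : ℝ) / 12 else if h = 3 then 1 / 36 else if h = 5 then 1 / 12 else if h = 6 then 29 / 36 else 0)) h = 0 := fun h hh => nu_top6 h (by omega)
  have sh_top : ∀ h, 7 < h → (fun h : ℕ => (if h = 3 then (1 : ℝ) / 12 else if h = 4 then 1 / 36 else if h = 6 then 1 / 12 else if h = 7 then 29 / 36 else 0)) h = 0 := by
    intro h hh; dsimp only; rw [if_neg (by omega), if_neg (by omega), if_neg (by omega), if_neg (by omega)]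
  have mx_top : ∀ h, 7 < h → (fun h : ℕ => (if h = 2 then (1 : ℝ) / 144 else if h = 3 then 17 / 216 else if h = 4 then 11 / 432 else if h = 5 then 1 / 144 else if h = 6 then 31 / 216 else if h = 7 then 319 / 432 else 0)) h = 0 := by
    intro h hh; dsimp only
    rw [if_neg (by omega), if_neg (by omega), if_neg (by omega), if_neg (by omega), if_neg (by omega), if_neg (by omega)]
  have nu_mass : ∑ h ∈ Finset.range (7 + 1), (fun h : ℕ => (if h = 2 then (1 : ℝ) / 12 else if h = 3 then 1 / 36 else if h = 5 then 1 / 12 else if h = 6 then 29 / 36 else 0)) h = 1 := by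
    simp only [Finset.sum_range_succ, Finset.sum_range_zero]; norm_num
  have sh_mass : ∑ h ∈ Finset.range (7 + 1), (fun h : ℕ => (if h = 3 then (1 : ℝ) / 12 else if h = 4 then 1 / 36 else if h = 6 then 1 / 12 else if h = 7 then 29 / 36 else 0)) h = 1 := by
    simp only [Finset.sum_range_succ, Finset.sum_range_zero]; norm_num
  have mx_mass : ∑ h ∈ Finset.range (7 + 1), (fun h : ℕ => (if h = 2 then (1 : ℝ) / 144 else if h = 3 then 17 / 216 else if h = 4 then 11 / 432 else if h = 5 then 1 / 144 else if h = 6 then 31 / 216 else if h = 7 then 319 / 432 else 0)) h = 1 := by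
    simp only [Finset.sum_range_succ, Finset.sum_range_zero]; norm_num
  have nu_mass6 : ∑ h ∈ Finset.range (6 + 1), (fun h : ℕ => (if h = 2 then (1 : ℝ) / 12 else if h = 3 then 1 / 36 else if h = 5 then 1 / 12 else if h = 6 then 29 / 36 else 0)) h = 1 := by
    simp only [Finset.sum_range_succ, Finset.sum_range_zero]; norm_num
  have nu_mean : ∑ h ∈ Finset.range (6 + 1), (h : ℝ) * (fun h : ℕ => (if h = 2 then (1 : ℝ) / 12 else if h = 3 then 1 / 36 else if h = 5 then 1 / 12 else if h = 6 then 29 / 36 else 0)) h = 11 / 2 := by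
    simp only [Finset.sum_range_succ, Finset.sum_range_zero]; norm_num
  -- pointwise identification of the binder's `shiftBut ν 1 0` and of the mixture
  have sh_apply : ∀ h : ℕ, (if h = 0 then (0 : ℝ) else 0) + (if 1 ≤ h then (fun h : ℕ => (if h = 2 then (1 : ℝ) / 12 else if h = 3 then 1 / 36 else if h = 5 then 1 / 12 else if h = 6 then 29 / 36 else 0)) (h - 1) else 0) - (if h = 1 then (0 : ℝ) else 0)
      = (fun h : ℕ => (if h = 3 then (1 : ℝ) / 12 else if h = 4 then 1 / 36 else if h = 6 then 1 / 12 else if h = 7 then 29 / 36 else 0)) h := by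
    intro h
    simp only [ite_self, zero_add, sub_zero]
    rcases h with _ | _ | _ | _ | _ | _ | _ | _ | h
    all_goals norm_num
    rw [if_neg (by omega), if_neg (by omega), if_neg (by omega), if_neg (by omega),
      if_neg (by omega), if_neg (by omega), if_neg (by omega), if_neg (by omega)]
  have mx_apply : ∀ h : ℕ, (1 - (11 / 12 : ℝ)) * (fun h : ℕ => (if h = 2 then (1 : ℝ) / 12 else if h = 3 then 1 / 36 else if h = 5 then 1 / 12 else if h = 6 then 29 / 36 else 0)) h + 11 / 12 *
      ((if h = 0 then (0 : ℝ) else 0) + (if 1 ≤ h then (fun h : ℕ => (if h = 2 then (1 : ℝ) / 12 else if h = 3 then 1 / 36 else if h = 5 then 1 / 12 else if h = 6 then 29 / 36 else 0)) (h - 1) else 0) - (if h = 1 then (0 : ℝ) else 0)) = (fun h : ℕ => (if h = 2 then (1 : ℝ) / 144 else if h = 3 then 17 / 216 else if h = 4 then 11 / 432 else if h = 5 then 1 / 144 else if h = 6 then 31 / 216 else if h = 7 then 319 / 432 else 0)) h := by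
    intro h
    rw [sh_apply h]
    dsimp only
    rcases h with _ | _ | _ | _ | _ | _ | _ | _ | h
    all_goals norm_num
    all_goals (try simp)
  -- HYPOTHESIS A: `ν` DEC at `(11/12, 11/2, 5)`, top `7`
  have hypA : DECAtT (11 / 12) (11 / 2) 5 7 (fun h : ℕ => (if h = 2 then (1 : ℝ) / 12 else if h = 3 then 1 / 36 else if h = 5 then 1 / 12 else if h = 6 then 29 / 36 else 0)) := by
    rw [decAtT_iff_flowAtT _ _ 5 7 _ (by norm_num) (by norm_num) nu_top nu_mass]
    have u25 : usage (11 / 12 : ℝ) (11 / 2) 5 2 5 = 127 / 17 := by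
      rw [usage_of_mid (11 / 12) (11 / 2) (1 / 2) 5 2 5 (by norm_num) (by norm_num) (by norm_num)]; norm_num
    have u26 : usage (11 / 12 : ℝ) (11 / 2) 5 2 6 = 11 := by
      rw [usage_of_giant (11 / 12) (11 / 2) 5 2 6 (by norm_num)]; norm_num
    refine ⟨fun l h => if l = 2 then (if h = 5 then 1 / 99 else if h = 6 then 29 / 396 else 0) else 0, ?_, ?_, ?_, ?_⟩
    · intro l h
      dsimp only
      split_ifs <;> norm_num
    · intro l h hlh
      dsimp only at hlh
      split_ifs at hlh with h1 h2 h3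
      · subst h1; subst h2; norm_num
      · subst h1; subst h3; norm_num
      · exact absurd hlh (lt_irrefl 0)
      · exact absurd hlh (lt_irrefl 0)
    · intro l hl hlow
      interval_cases l
      · simp only [Finset.sum_range_succ, Finset.sum_range_zero]; norm_num
      · simp only [Finset.sum_range_succ, Finset.sum_range_zero]; norm_num
      · simp only [Finset.sum_range_succ, Finset.sum_range_zero]; norm_num
      · exfalso; norm_num at hlow
      · exfalso; norm_num at hlow
      · exfalso; norm_num at hlow
    · intro h hh habs
      interval_cases h <;> simp only [Finset.sum_range_succ, Finset.sum_range_zero] <;> norm_num [u25, u26]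
  -- HYPOTHESIS B: `shiftBut ν 1 0` DEC at `(11/12, 13/2, 5)`, top `7`
  have hypB : DECAtT (11 / 12) (13 / 2) 5 7 (fun h : ℕ => (if h = 3 then (1 : ℝ) / 12 else if h = 4 then 1 / 36 else if h = 6 then 1 / 12 else if h = 7 then 29 / 36 else 0)) := by
    rw [decAtT_iff_flowAtT _ _ 5 7 _ (by norm_num) (by norm_num) sh_top sh_mass]
    have u34 : usage (11 / 12 : ℝ) (13 / 2) 5 3 4 = 127 / 17 := by
      rw [usage_of_mid (11 / 12) (13 / 2) (1 / 2) 5 3 4 (by norm_num) (by norm_num) (by norm_num)]; norm_num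
    have u36 : usage (11 / 12 : ℝ) (13 / 2) 5 3 6 = 11 := by
      rw [usage_of_giant (11 / 12) (13 / 2) 5 3 6 (by norm_num)]; norm_num
    have u37 : usage (11 / 12 : ℝ) (13 / 2) 5 3 7 = 11 := by
      rw [usage_of_giant (11 / 12) (13 / 2) 5 3 7 (by norm_num)]; norm_num
    refine ⟨fun l h => if l = 3 then (if h = 4 then 1 / 396 else if h = 6 then 1 / 132 else if h = 7 then 29 / 396 else 0) else 0,
      ?_, ?_, ?_, ?_⟩
    · intro l h
      dsimp only
      split_ifs <;> norm_num
    · intro l h hlh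
      dsimp only at hlh
      split_ifs at hlh with h1 h2 h3 h4
      · subst h1; subst h2; norm_num
      · subst h1; subst h3; norm_num
      · subst h1; subst h4; norm_num
      · exact absurd hlh (lt_irrefl 0)
      · exact absurd hlh (lt_irrefl 0)
    · intro l hl hlow
      interval_cases l
      · simp only [Finset.sum_range_succ, Finset.sum_range_zero]; norm_num
      · simp only [Finset.sum_range_succ, Finset.sum_range_zero]; norm_num
      · simp only [Finset.sum_range_succ, Finset.sum_range_zero]; norm_num
      · simp only [Finset.sum_range_succ, Finset.sum_range_zero]; norm_num
      · exfalso; norm_num at hlow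
      · exfalso; norm_num at hlow
    · intro h hh habs
      interval_cases h <;> simp only [Finset.sum_range_succ, Finset.sum_range_zero] <;> norm_num [u34, u36, u37]
  -- THE CONCLUSION FAILS: the mixture is NOT DEC at `(11/12, 77/12, 5)`, top `7`
  have hypC : ¬ DECAtT (11 / 12) (77 / 12) 5 7 (fun h : ℕ => (if h = 2 then (1 : ℝ) / 144 else if h = 3 then 17 / 216 else if h = 4 then 11 / 432 else if h = 5 then 1 / 144 else if h = 6 then 31 / 216 else if h = 7 then 319 / 432 else 0)) := by
    rw [decAtT_iff_flowAtT _ _ 5 7 _ (by norm_num) (by norm_num) mx_top mx_mass]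
    rintro ⟨f, hf0, hsupp, hlow, hcap⟩
    have u25 : usage (11 / 12 : ℝ) (77 / 12) 5 2 5 = 49 / 5 := by
      rw [usage_of_mid (11 / 12) (77 / 12) (29 / 36) 5 2 5 (by norm_num) (by norm_num) (by norm_num)]; norm_num
    have u34 : usage (11 / 12 : ℝ) (77 / 12) 5 3 4 = 7 := by
      rw [usage_of_mid (11 / 12) (77 / 12) (5 / 12) 5 3 4 (by norm_num) (by norm_num) (by norm_num)]; norm_num
    have u35 : usage (11 / 12 : ℝ) (77 / 12) 5 3 5 = 247 / 41 := by
      rw [usage_of_mid (11 / 12) (77 / 12) (5 / 24) 5 3 5 (by norm_num) (by norm_num) (by norm_num)]; norm_num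
    have ug : ∀ l h, 5 + 1 ≤ h → usage (11 / 12 : ℝ) (77 / 12) 5 l h = 11 := by
      intro l h hh; rw [usage_of_giant (11 / 12) (77 / 12) 5 l h hh]; norm_num
    -- zero pattern of any flow: rows 0, 1 (zero-mass lows), rows 4, 5 (not lows), and the incompatible / forbidden cells of rows 2, 3
    have hz : ∀ l h : ℕ, ¬ (l ≤ 5 ∧ 2 * (l : ℝ) < 77 / 12 ∧ h ≤ 7 ∧ (5 + 1 ≤ h ∨ (77 / 12 : ℝ) < (l : ℝ) + h)) → f l h = 0 := by
      intro l h hn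
      by_contra hne
      exact hn (hsupp l h (lt_of_le_of_ne (hf0 l h) (Ne.symm hne)))
    have r0 : ∀ h, f 0 h = 0 := by
      intro h
      have hs := hlow 0 (by norm_num) (by norm_num)
      norm_num at hs
      by_cases hh : h < 7 + 1
      · exact (Finset.sum_eq_zero_iff_of_nonneg (fun k _ => hf0 0 k)).1 hs h (Finset.mem_range.2 hh)
      · exact hz 0 h (fun hc => hh (by have h7 := hc.2.2.1; omega))
    have r1 : ∀ h, f 1 h = 0 := by
      intro h
      have hs := hlow 1 (by norm_num) (by norm_num)
      norm_num at hs
      by_cases hh : h < 7 + 1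
      · exact (Finset.sum_eq_zero_iff_of_nonneg (fun k _ => hf0 1 k)).1 hs h (Finset.mem_range.2 hh)
      · exact hz 1 h (fun hc => hh (by have h7 := hc.2.2.1; omega))
    have r4 : ∀ h, f 4 h = 0 := fun h => hz 4 h (by norm_num)
    have r5 : ∀ h, f 5 h = 0 := fun h => hz 5 h (by norm_num)
    have z20 : f 2 0 = 0 := hz 2 0 (by norm_num)
    have z21 : f 2 1 = 0 := hz 2 1 (by norm_num)
    have z22 : f 2 2 = 0 := hz 2 2 (by norm_num)
    have z23 : f 2 3 = 0 := hz 2 3 (by norm_num)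
    have z24 : f 2 4 = 0 := hz 2 4 (by norm_num)
    have z30 : f 3 0 = 0 := hz 3 0 (by norm_num)
    have z31 : f 3 1 = 0 := hz 3 1 (by norm_num)
    have z32 : f 3 2 = 0 := hz 3 2 (by norm_num)
    have z33 : f 3 3 = 0 := hz 3 3 (by norm_num)
    -- the two low equations and the four capacity inequalities, zero cells removed, rates evaluated
    have e2 := hlow 2 (by norm_num) (by norm_num)
    have e3 := hlow 3 (by norm_num) (by norm_num)
    have c4 := hcap 4 (by norm_num) (Or.inr (by norm_num))
    have c5 := hcap 5 (by norm_num) (Or.inr (by norm_num))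
    have c6 := hcap 6 (by norm_num) (Or.inl (by norm_num))
    have c7 := hcap 7 (by norm_num) (Or.inl (by norm_num))
    simp only [Finset.sum_range_succ, Finset.sum_range_zero, zero_add] at e2 e3 c4 c5 c6 c7
    norm_num at e2 e3 c4 c5 c6 c7
    rw [z20, z21, z22, z23, z24] at e2
    rw [z30, z31, z32, z33] at e3
    rw [r0 4, r1 4, z24, r4 4, r5 4, u34] at c4
    rw [r0 5, r1 5, r4 5, r5 5, u25, u35] at c5
    rw [r0 6, r1 6, r4 6, r5 6, ug 2 6 (by norm_num), ug 3 6 (by norm_num)] at c6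
    rw [r0 7, r1 7, r4 7, r5 7, ug 2 7 (by norm_num), ug 3 7 (by norm_num)] at c7
    norm_num at c4 c5 c6 c7
    nlinarith [hf0 2 5, hf0 2 6, hf0 2 7, hf0 3 4, hf0 3 5, hf0 3 6, hf0 3 7]
  -- assemble
  refine ⟨11 / 12, 0, 11 / 12, 11 / 2, 1, 5, 6, (fun h : ℕ => (if h = 2 then (1 : ℝ) / 12 else if h = 3 then 1 / 36 else if h = 5 then 1 / 12 else if h = 6 then 29 / 36 else 0)), by norm_num, by norm_num, le_rfl, ?_, by norm_num, by norm_num, le_rfl,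
    ?_, nu_top6, nu_mass6, nu_mean.symm, by norm_num, hypA, ?_, ?_⟩
  · norm_num
  · intro h; dsimp only; split_ifs <;> norm_num
  · have hfun : (fun h : ℕ => (if h = 0 then (0 : ℝ) else 0) + (if 1 ≤ h then (fun h : ℕ => (if h = 2 then (1 : ℝ) / 12 else if h = 3 then 1 / 36 else if h = 5 then 1 / 12 else if h = 6 then 29 / 36 else 0)) (h - 1) else 0) - (if h = 1 then (0 : ℝ) else 0))
        = (fun h : ℕ => (if h = 3 then (1 : ℝ) / 12 else if h = 4 then 1 / 36 else if h = 6 then 1 / 12 else if h = 7 then 29 / 36 else 0)) := funext sh_apply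
    rw [hfun, show ((11 : ℝ) / 2 + ((1 : ℕ) : ℝ) * (1 - 0)) = 13 / 2 by norm_num]
    exact hypB
  · have hfun : (fun h : ℕ => (1 - (11 / 12 : ℝ)) * (fun h : ℕ => (if h = 2 then (1 : ℝ) / 12 else if h = 3 then 1 / 36 else if h = 5 then 1 / 12 else if h = 6 then 29 / 36 else 0)) h + 11 / 12 *
        ((if h = 0 then (0 : ℝ) else 0) + (if 1 ≤ h then (fun h : ℕ => (if h = 2 then (1 : ℝ) / 12 else if h = 3 then 1 / 36 else if h = 5 then 1 / 12 else if h = 6 then 29 / 36 else 0)) (h - 1) else 0) - (if h = 1 then (0 : ℝ) else 0))) = (fun h : ℕ => (if h = 2 then (1 : ℝ) / 144 else if h = 3 then 17 / 216 else if h = 4 then 11 / 432 else if h = 5 then 1 / 144 else if h = 6 then 31 / 216 else if h = 7 then 319 / 432 else 0)) :=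
      funext mx_apply
    rw [hfun, show ((11 : ℝ) / 2 + ((1 : ℕ) : ℝ) * (11 / 12) * (1 - 0)) = 77 / 12 by norm_num]
    exact hypC

end LawDec

end Quant

end Summit.CriticalPhenomena.PercolationContinuityZ3.Theorems
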